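import Mathlib.Data.Sym.Card
import Mathlib.Data.Finsupp.Multiset
import Mathlib.LinearAlgebra.Dimension.Finite
import Mathlib.RingTheory.MvPolynomial.Basic
import Literature.Computability.AlgebraicComplexity.AndrewsForbes2022Applications
import Literature.Computability.AlgebraicComplexity.SecondFundamentalTheoremGL

/-!
# Andrews–Forbes 2022, Lemma 2.6 — the seed length / degree trade-off for hitting set generators (PROVED);
# Lemma 2.9 (1) — the image of `𝒢_{n,m,r}` is the set of matrices of rank `≤ r` (PROVED)

R. Andrews, M. A. Forbes, *Ideals, determinants, and straightening: proving and using lower bounds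
for polynomial ideals*, STOC 2022 = arXiv:2112.00792 [`AndrewsForbes2022`], §2.2, **Lemma 2.6**
(printed p. 12; `lit read paper:arxiv-2112.00792` p0013:L1–L19):

> Let `𝒞 ⊆ F[x]` be a set of polynomials such that `𝒞` contains all linear polynomials.  Suppose
> `𝒢 : F^ℓ → F^n` is a hitting set generator for `𝒞` of degree `d`.  Then we must have
> `binom(ℓ + d, d) ≥ n`.  In particular, if `d` is a fixed constant independent of `n`, then
> `ℓ ≥ Ω(n^{1/d})`.

This is the optimality statement behind the generators of Thm. 6.8 / Prop. 7.2 ("the tradeoff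
between the seed length and degree of our generator is optimal up to the `n^{o(1)}` factor in the
seed length", p0032:L9; cf. `AndrewsForbes2022Prop72Proofs.lean`: degree `2^k`, seed length
`n^{1/2^k} s^{o(1)}`).  The companion statement file `AndrewsForbes2022Applications.lean` (val-lit
row AndrewsForbes2022-B) typed Def. 2.5 (`IsHittingSetGenFor`) and recorded Lemma 2.6 as not typed
("not invoked by the typed statements"); it is typed AND PROVED here (`AndrewsForbes2022_lemma_2_6`),
following the printed proof: the coordinates `𝒢_i` lie in the space of `ℓ`-variate polynomials of
degree `≤ d`, of dimension `binom(ℓ+d, d)` (here: AT MOST that, by the injection of the monomials of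
degree `≤ d` into the multisets of size `d` over `ℓ + 1` letters, `Lemma26.card_monomials_le`;
Mathlib's `MvPolynomial.restrictTotalDegree` with its monomial basis); if `n` exceeded it, a
non-trivial linear relation `L(𝒢_1, …, 𝒢_n) = 0` with `L ≠ 0` linear would contradict the
hitting property, as `L ∈ 𝒞`.  "Linear polynomials" are taken HOMOGENEOUS linear forms
`∑ c_i x_i` (what the printed proof uses; a weaker hypothesis on `𝒞` than all affine-linear
polynomials, so the typed statement implies the printed one).  The "in particular" clause
(`ℓ ≥ Ω(n^{1/d})`) is the elementary estimate `binom(ℓ+d, d) ≤ (ℓ+d)^d / d!`; not typed separately.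

Also typed and PROVED here, completing §2.3's Lemma 2.9 (bullet (2), degree, is
`totalDegree_matrixGenerator_le` in `AndrewsForbes2022Applications.lean`; bullet (3), formula
clause, is `formulaComplexity_matrixGenerator_le` in `AndrewsForbes2022Prop72Proofs.lean`):
**Lemma 2.9 (1)** (p0013:L47), "the image of `𝒢_{n,m,r}` contains all `n × m` matrices of rank at
most `r`" — `exists_eval_matrixGenerator_eq_of_rank_le` (rank factorisation, the tree's
`exists_eq_mul_of_rank_le`), with the converse inclusion `rank_eval_matrixGenerator_le`.

No named facts (D-0026): proved theorems and their plumbing.  Honest framing: typed literature for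
the val-lit NP corpus (V4 companion); VP ≠ VNP is NOT proved and nothing here bears on it.
(val-lit t24 g3, 2026-08-26.)

## References

* [AndrewsForbes2022] R. Andrews, M. A. Forbes, STOC 2022, doi:10.1145/3519935.3520025,
  arXiv:2112.00792 — Def. 2.5, Lemma 2.6 (p. 12), Construction 2.8, Lemma 2.9 (p. 13).
-/

noncomputable section

open MvPolynomial

namespace Literature.Computability.AlgebraicComplexity

universe u

namespace Lemma26

variable {τ : Type}

/-- The monomials of degree `≤ d` in the variables `τ` (exponent vectors of weight `≤ d`), the
index set of the monomial basis of the polynomials of degree `≤ d` (Mathlib's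
`MvPolynomial.restrictTotalDegree`). [cite: AndrewsForbes2022, Lemma 2.6 (proof)] -/
def monomialsLE (τ : Type) (d : ℕ) : Set (τ →₀ ℕ) := {n | (n.sum fun _ e => e) ≤ d}

/-- `filterMap id` discards a block of `none`s. [cite: AndrewsForbes2022, Lemma 2.6 (proof)] -/
theorem filterMap_id_replicate_none (k : ℕ) :
    Multiset.filterMap id (Multiset.replicate k (none : Option τ)) = 0 := by
  induction k with
  | zero => rw [Multiset.replicate_zero, Multiset.filterMap_zero]
  | succ k ih => rw [Multiset.replicate_succ, Multiset.filterMap_cons_none _ _ rfl, ih]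

/-- Padding a monomial of degree `≤ d` with a slack letter to a multiset of size exactly `d` over
`τ ⊕ {∗}` (the stars-and-bars count `binom(ℓ + d, d)` of the printed proof, as an injection).
[cite: AndrewsForbes2022, Lemma 2.6 (proof)] -/
def pad (d : ℕ) (n : monomialsLE τ d) : Sym (Option τ) d :=
  ⟨(Finsupp.toMultiset n.1).map some + Multiset.replicate (d - n.1.sum fun _ e => e) none, by
    have h := n.2
    simp only [monomialsLE, Set.mem_setOf_eq] at h
    rw [Multiset.card_add, Multiset.card_map, Finsupp.card_toMultiset, Multiset.card_replicate]
    change (n.1.sum fun _ e => e) + _ = d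
    omega⟩

/-- The padding is injective (strip the slack letters). [cite: AndrewsForbes2022, Lemma 2.6 (proof)] -/
theorem pad_injective (d : ℕ) : Function.Injective (pad (τ := τ) d) := by
  intro a b h
  have h1 := congr_arg (fun s : Sym (Option τ) d => Multiset.filterMap id (s : Multiset (Option τ))) h
  simp only [pad, Sym.coe_mk, Multiset.filterMap_add, Multiset.filterMap_map, Function.id_comp,
    Multiset.filterMap_some, filterMap_id_replicate_none, add_zero] at h1
  classical
  have h2 := congr_arg Multiset.toFinsupp h1
  rw [Finsupp.toMultiset_toFinsupp, Finsupp.toMultiset_toFinsupp] at h2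
  exact Subtype.ext h2

/-- **"The space of `ℓ`-variate polynomials of degree at most `d` is a vector space of dimension
`binom(ℓ+d, d)`"** (p0013:L10), in the form used: there are at most `binom(ℓ + d, d)` monomials of
degree `≤ d` in `ℓ` variables. [cite: AndrewsForbes2022, Lemma 2.6 (proof)] -/
theorem finite_monomialsLE [Fintype τ] (d : ℕ) : (monomialsLE τ d).Finite := by
  classical
  haveI : Finite (monomialsLE τ d) := Finite.of_injective _ (pad_injective d)
  exact Set.toFinite _

/-- The count: `#(monomials of degree ≤ d) ≤ binom(ℓ + d, d)` for any `Fintype` structure on the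
set. [cite: AndrewsForbes2022, Lemma 2.6 (proof)] -/
theorem card_monomialsLE_le [Fintype τ] (d : ℕ) [Fintype (monomialsLE τ d)] :
    Fintype.card (monomialsLE τ d) ≤ (Fintype.card τ + d).choose d := by
  classical
  calc Fintype.card (monomialsLE τ d) ≤ Fintype.card (Sym (Option τ) d) :=
        Fintype.card_le_of_injective _ (pad_injective d)
    _ = (Fintype.card τ + d).choose d := by
        rw [Sym.card_sym_eq_multichoose, Fintype.card_option, Nat.multichoose_eq]
        congr 1
        omega

end Lemma26

open Lemma26 in
/-- **Andrews–Forbes 2022, Lemma 2.6** (PROVED; p0013:L1–L19): let `𝒞 ⊆ F[x_M]` contain every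
linear form `∑ c_i x_i`, and let `𝒢 : F^τ → F^M` (coordinates `G m ∈ F[y_τ]`) be a hitting set
generator for `𝒞` (Def. 2.5, `IsHittingSetGenFor`) of degree `≤ d` (every coordinate of total
degree `≤ d`).  Then `binom(ℓ + d, d) ≥ n` with `ℓ = |τ|` the seed length and `n = |M|` the number of
outputs.  Printed proof: the `G m` lie in the `binom(ℓ+d, d)`-dimensional space of polynomials of
degree `≤ d`; were `n` larger, a non-trivial linear relation `L(G_1, …, G_n) = 0`, `L ≠ 0` linear,
`L ∈ 𝒞`, would contradict the hitting property. [cite: AndrewsForbes2022, Lemma 2.6] -/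
theorem AndrewsForbes2022_lemma_2_6 {F : Type u} [Field F] {M τ : Type} [Fintype M] [Fintype τ]
    {𝒞 : Set (MvPolynomial M F)} (h𝒞 : ∀ c : M → F, (∑ m, C (c m) * X m) ∈ 𝒞)
    {G : M → MvPolynomial τ F} (hG : IsHittingSetGenFor F 𝒞 G) {d : ℕ}
    (hd : ∀ m, (G m).totalDegree ≤ d) :
    Fintype.card M ≤ (Fintype.card τ + d).choose d := by
  classical
  haveI : Fintype (monomialsLE τ d) := (finite_monomialsLE d).fintype
  -- the space of polynomials of degree `≤ d` and its monomial basis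
  have hR : restrictTotalDegree τ F d = restrictSupport F (monomialsLE τ d) := rfl
  haveI : Module.Finite F (restrictTotalDegree τ F d) :=
    Module.Finite.of_basis (hR ▸ basisRestrictSupport F (monomialsLE τ d))
  have hrank : Module.finrank F (restrictTotalDegree τ F d) = Fintype.card (monomialsLE τ d) :=
    Module.finrank_eq_card_basis (hR ▸ basisRestrictSupport F (monomialsLE τ d))
  -- the coordinates as elements of that space
  have hmem : ∀ m, G m ∈ restrictTotalDegree τ F d := fun m => by
    rw [mem_restrictTotalDegree]; exact hd m
  obtain ⟨G', hG'⟩ : ∃ G' : M → restrictTotalDegree τ F d, ∀ m, (G' m : MvPolynomial τ F) = G m :=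
    ⟨fun m => ⟨G m, hmem m⟩, fun m => rfl⟩
  by_cases hli : LinearIndependent F G'
  · exact (hli.fintype_card_le_finrank.trans_eq hrank).trans (card_monomialsLE_le d)
  · -- a non-trivial linear relation among the coordinates contradicts the hitting property
    exfalso
    obtain ⟨c, hc0, m₀, hm₀⟩ := Fintype.not_linearIndependent_iff.mp hli
    have hrel : ∑ m, c m • G m = 0 := by
      have := congr_arg (Submodule.subtype (restrictTotalDegree τ F d)) hc0
      rw [map_sum, map_zero] at this
      simpa [hG'] using this
    refine hG _ (h𝒞 c) ?_ ?_
    · -- `L = ∑ c_m x_m ≠ 0`: its coefficient at `x_{m₀}` is `c_{m₀} ≠ 0`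
      intro hL
      have hcoeff := congr_arg (coeff (Finsupp.single m₀ 1)) hL
      rw [coeff_sum, coeff_zero] at hcoeff
      simp_rw [coeff_C_mul, coeff_X, Finsupp.single_left_inj one_ne_zero] at hcoeff
      simp only [mul_ite, mul_one, mul_zero, Finset.sum_ite_eq', Finset.mem_univ, if_true] at hcoeff
      exact hm₀ hcoeff
    · -- `L(G) = ∑ c_m G_m = 0`
      rw [map_sum]
      simp_rw [map_mul, bind₁_C_right, bind₁_X_right, ← smul_eq_C_mul]
      exact hrel

/-! ## Lemma 2.9 (1): the image of `𝒢_{n,m,r}` is all of rank `≤ r` -/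

/-- **Andrews–Forbes 2022, Lemma 2.9 (1)** (PROVED; p0013:L47: "The image of `𝒢_{n,m,r}`
contains all `n × m` matrices of rank at most `r`"): every `A ∈ F^{n × m}` with `rank A ≤ r` is
`𝒢_{n,m,r}(Y, Z) = YZ` for some seed `(Y, Z)` — rank factorisation through `F^r` (the tree's
`exists_eq_mul_of_rank_le`).  (The image is also contained in the rank-`≤ r` matrices, as
`rank(YZ) ≤ r`; with Lemma 2.7 this is what makes `f(𝒢_{n,m,r}) = 0` say "`f` vanishes on all
matrices of rank `≤ r`", the input of Lemma 2.10.) [cite: AndrewsForbes2022, Lemma 2.9 (1)] -/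
theorem exists_eval_matrixGenerator_eq_of_rank_le {F : Type u} [Field F] {n m r : ℕ}
    (A : Matrix (Fin n) (Fin m) F) (hA : A.rank ≤ r) :
    ∃ y : MatGenSeed n m r → F, ∀ ij, MvPolynomial.eval y (matrixGenerator F n m r ij) = A ij.1 ij.2 := by
  obtain ⟨U, W, hUW⟩ := exists_eq_mul_of_rank_le A hA
  refine ⟨Sum.elim (fun ik => U ik.1 ik.2) (fun kj => W kj.1 kj.2), fun ij => ?_⟩
  rw [hUW, Matrix.mul_apply, matrixGenerator]
  simp only [map_sum, map_mul, MvPolynomial.eval_X, Sum.elim_inl, Sum.elim_inr]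

/-- Conversely every value of `𝒢_{n,m,r}` has rank `≤ r` (`rank(YZ) ≤ r`), so the image of
`𝒢_{n,m,r}` is exactly the set of matrices of rank `≤ r`. [cite: AndrewsForbes2022, Lemma 2.9 (1)] -/
theorem rank_eval_matrixGenerator_le {F : Type u} [Field F] {n m r : ℕ} (y : MatGenSeed n m r → F) :
    (Matrix.of fun i j => MvPolynomial.eval y (matrixGenerator F n m r (i, j))).rank ≤ r := by
  have h : (Matrix.of fun i j => MvPolynomial.eval y (matrixGenerator F n m r (i, j))) =
      (Matrix.of fun (i : Fin n) (k : Fin r) => y (Sum.inl (i, k))) *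
        (Matrix.of fun (k : Fin r) (j : Fin m) => y (Sum.inr (k, j))) := by
    ext i j
    rw [Matrix.of_apply, Matrix.mul_apply, matrixGenerator]
    simp only [map_sum, map_mul, MvPolynomial.eval_X, Matrix.of_apply]
  rw [h]
  refine (Matrix.rank_mul_le_left _ _).trans ?_
  simpa using Matrix.rank_le_width (Matrix.of fun (i : Fin n) (k : Fin r) => y (Sum.inl (i, k)))

end Literature.Computability.AlgebraicComplexity
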